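/-
Copyright (c) 2026 the pub-hodgecm-mathlib formalisation cell (harness21).  Prover seat hodgecm-mathlib-K2Liu-p13 (g0), Track B «K2-LIT»,
#184♮ = hLiu418 = `stmt-HodgeConjecture-24832`; Road I v3 organ U1-CT-ind STAGE 2 (Q2), file F4-1f (LEAD F0P6-plan (g14) 10:39:33Z «F4-1c → F4-2 → F4 → F5 → D-U1 stage 3 =»).
-/
import Summits.HodgeConjecture.HodgeConjecture.Theorems.K2LiuKlingenUnipotentNormal    -- ★∕📤 F4-1e: `conj_mem_klingenUnip`
import Summits.HodgeConjecture.HodgeConjecture.Theorems.K2LiuKlingenRationalCells      -- ★ F4-1c: `coe_adelicVal_toAdelic`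
import HarnessLib

/-!
# Crux `HLiu418`, Road I v3, organ U1 stage 2 (Q2), file F4-1f: THE IDENTITY-CELL INTEGRAND IS CONSTANT —
# `f(Ψ(q) · u · h) = f(Ψ(q) · h)` for `q ∈ Q(L⁺)`, `u ∈ N_Q(𝔸)`, `f` a Siegel section

Cell `hodgecm-mathlib`, crux item hLiu418 = `stmt-HodgeConjecture-24832`; squad K2 ∕ K2Liu; LEAD F0P6-plan (g14), co-dealer K2E5-plan (g7); prover K2Liu-p13 (g0).
THEOREMS ONLY (no `def`, no instance, no notation, no named-fact hypothesis, no `sorry`); lane `--supports stmt-HodgeConjecture-24832 --as helper` (count-neutral).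
`n = 2`; the transport `Ψ` and ★ F3's clauses (T1)(T3)(T4) are hypotheses BY VALUE.
* §1 the rational letter `q ∈ Q(L⁺)` read as an ADELIC letter: `(jAdelic 4)⁻¹ (toAdelic q)` has matrix `q.map (L ↪ 𝔸_L)` (`coe_jAdelic_symm_toAdelic`) and lies in
  `klingen 𝔸_L (c ⊗ 1)` (`jAdelic_symm_toAdelic_mem_klingen`).
* §2 **`conj_mem_klingenUnipA`**: `Ψ(toAdelic q) · u · Ψ(toAdelic q)⁻¹ ∈ N_Q(𝔸)` for `q ∈ Q(L⁺)`, `u ∈ N_Q(𝔸) = klingenUnipA Ψ` (📤 F4-1e `conj_mem_klingenUnip` at `R := 𝔸_L`).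
* §3 **`apply_transport_klingen_mul_klingenUnipA`**: `f (Ψ(toAdelic q) · u · h) = f (Ψ(toAdelic q) · h)` for every Siegel section `f` of `I(s, χ)` (★ F4-1
  `apply_klingenUnipA_mul`) — the `N_Q(𝔸)`-integrand of the Q-constant term through an identity-cell representative is CONSTANT, so the identity cell contributes
  `(∫ β dνN) · Σ_{cell 1} f(γ h)` (file F4).
[Xiong2013 §4 Prop. 4.1], [MoeglinWaldspurger1995 II.1.7], [GanTakeda2011SiegelWeil §7.2].
HONEST LABEL.  Count-neutral helper: `HC_CM` is proved only modulo the 7 printed citations (2 remaining named inputs: hLiu418 = `stmt-HodgeConjecture-24832`,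
h413 = `stmt-HodgeConjecture-24833`) until rung 0 closes.
-/

set_option autoImplicit false
set_option linter.dupNamespace false -- the mandated namespace repeats `HodgeConjecture.HodgeConjecture`

noncomputable section

open scoped Matrix
open NumberField IsDedekindDomain

namespace Summit.HodgeConjecture.HodgeConjecture.Cruxes.HLiu418.K2LiuKlingenCellOneConstant

open Literature.NumberTheory.Automorphic Literature.NumberTheory.Automorphic.UnitaryGroup
open Literature.NumberTheory.GelbartRogawski1991 Literature.NumberTheory.GelbartRogawski1991.GRConstruction
open Literature.NumberTheory.GaloisRepresentations
open Literature.NumberTheory.K2Lit.SiegelDoubled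
open Summit.HodgeConjecture.HodgeConjecture.Cruxes.HLiu418.K2LiuDoubledUTwoTwoBorelFrame
open Summit.HodgeConjecture.HodgeConjecture.Cruxes.HLiu418.K2LiuKlingenParabolicDefs
open Summit.HodgeConjecture.HodgeConjecture.Cruxes.HLiu418.K2LiuKlingenUnipotentDefs
open Summit.HodgeConjecture.HodgeConjecture.Cruxes.HLiu418.K2LiuKlingenUnipotentAdelicDefs
open Summit.HodgeConjecture.HodgeConjecture.Cruxes.HLiu418.K2LiuKlingenUnipotentNormal (conj_mem_klingenUnip)
open Summit.HodgeConjecture.HodgeConjecture.Cruxes.HLiu418.K2LiuKlingenRationalCells (coe_adelicVal_toAdelic)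
open Summit.HodgeConjecture.HodgeConjecture.Cruxes.HLiu418.K2LiuSiegelDoubledLeviMatrix (conjAdele_conjAdele')
open UnitaryDualPair

variable (L : Type) [Field L] [NumberField L] [IsCMField L]

/-! ## §1 A rational Klingen letter read as an adelic letter -/

/-- the matrix of `(jAdelic 4)⁻¹ (toAdelic q)` is `q.map (L ↪ 𝔸_L)`. [cite: Mok2014, §1 Notation p. 5] -/
theorem coe_jAdelic_symm_toAdelic (q : unitaryGroupOfForm ((IsCMField.complexConj L : L ≃ₐ[Fp L] L) : L →+* L) ((StdForm.antidiagonal 4).over L)) :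
    ((((jAdelic L 4).symm (UnitaryGroup.toAdelic (Fp L) L (IsCMField.complexConj L) (2 + 2) ((StdForm.antidiagonal (2 + 2)).over L) q) :
        unitaryGroupOfForm (conjAdele (Fp L) L (IsCMField.complexConj L)) ((StdForm.antidiagonal 4).over (AdeleRing (𝓞 L) L))) :
        GL (Fin 4) (AdeleRing (𝓞 L) L)) : Matrix (Fin 4) (Fin 4) (AdeleRing (𝓞 L) L)) =
      ((q : GL (Fin 4) L) : Matrix (Fin 4) (Fin 4) L).map (algebraMap L (AdeleRing (𝓞 L) L)) := by
  rw [← adelicVal_jAdelic L 4 ((jAdelic L 4).symm (UnitaryGroup.toAdelic (Fp L) L (IsCMField.complexConj L) (2 + 2) ((StdForm.antidiagonal (2 + 2)).over L) q)),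
    MulEquiv.apply_symm_apply, coe_adelicVal_toAdelic L (2 + 2) q]

/-- `(jAdelic 4)⁻¹ (toAdelic q) ∈ klingen 𝔸_L (c ⊗ 1)` for `q ∈ klingen L c` (the zero pattern survives the embedding). [cite: Xiong2013, §7 Lemma 7.1] -/
theorem jAdelic_symm_toAdelic_mem_klingen {q : unitaryGroupOfForm ((IsCMField.complexConj L : L ≃ₐ[Fp L] L) : L →+* L) ((StdForm.antidiagonal 4).over L)}
    (hq : q ∈ klingen L ((IsCMField.complexConj L : L ≃ₐ[Fp L] L) : L →+* L)) :
    (jAdelic L 4).symm (UnitaryGroup.toAdelic (Fp L) L (IsCMField.complexConj L) (2 + 2) ((StdForm.antidiagonal (2 + 2)).over L) q) ∈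
      klingen (AdeleRing (𝓞 L) L) (conjAdele (Fp L) L (IsCMField.complexConj L)) := by
  obtain ⟨h10, h20, h30⟩ := hq
  rw [mem_klingen_iff, coe_jAdelic_symm_toAdelic]
  simp only [Matrix.map_apply, h10, h20, h30, map_zero, and_self]

/-! ## §2 `Ψ(Q(L⁺))` normalises `N_Q(𝔸)` -/

variable {L}
variable {N M : ℕ} {e : Fin N × Fin M ≃ Fin 2}
  {dV : Fin N → L} {hdV : ∀ i, IsCMField.complexConj L (dV i) = dV i}
  {dW : Fin M → L} {hdW : ∀ i, IsCMField.complexConj L (dW i) = dW i}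

/-- **`Ψ(toAdelic q) · u · Ψ(toAdelic q)⁻¹ ∈ N_Q(𝔸)`** for `q ∈ Q(L⁺)`, `u ∈ N_Q(𝔸)` (`N_Q ⊲ Q` at `R := 𝔸_L`, 📤 F4-1e). [cite: MoeglinWaldspurger1995, I.2.1] [cite: Xiong2013, §7 Lemma 7.1] -/
theorem conj_mem_klingenUnipA (Ψ : (quasiSplit (Fp L) L (IsCMField.complexConj L) (2 + 2)).Adelic ≃ₜ* HA L e dV hdV dW hdW)
    {q : unitaryGroupOfForm ((IsCMField.complexConj L : L ≃ₐ[Fp L] L) : L →+* L) ((StdForm.antidiagonal 4).over L)}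
    (hq : q ∈ klingen L ((IsCMField.complexConj L : L ≃ₐ[Fp L] L) : L →+* L)) {u : HA L e dV hdV dW hdW} (hu : u ∈ klingenUnipA Ψ) :
    Ψ (UnitaryGroup.toAdelic (Fp L) L (IsCMField.complexConj L) (2 + 2) ((StdForm.antidiagonal (2 + 2)).over L) q) * u *
        (Ψ (UnitaryGroup.toAdelic (Fp L) L (IsCMField.complexConj L) (2 + 2) ((StdForm.antidiagonal (2 + 2)).over L) q))⁻¹ ∈ klingenUnipA Ψ := by
  obtain ⟨y, hy, z, t, rfl⟩ := (mem_klingenUnipA_iff Ψ u).1 hu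
  have hqA := conj_mem_klingenUnip (conjAdele_conjAdele' L) (jAdelic_symm_toAdelic_mem_klingen L hq)
    (nKlingen_mem_klingenUnip (conjAdele_conjAdele' L) y hy z t)
  have key : Ψ (UnitaryGroup.toAdelic (Fp L) L (IsCMField.complexConj L) (2 + 2) ((StdForm.antidiagonal (2 + 2)).over L) q) *
      Ψ (jAdelic L 4 (nKlingen (AdeleRing (𝓞 L) L) (conjAdele (Fp L) L (IsCMField.complexConj L)) (conjAdele_conjAdele' L) y hy z t)) *
        (Ψ (UnitaryGroup.toAdelic (Fp L) L (IsCMField.complexConj L) (2 + 2) ((StdForm.antidiagonal (2 + 2)).over L) q))⁻¹ =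
      Ψ (jAdelic L 4 ((jAdelic L 4).symm (UnitaryGroup.toAdelic (Fp L) L (IsCMField.complexConj L) (2 + 2) ((StdForm.antidiagonal (2 + 2)).over L) q) *
        nKlingen (AdeleRing (𝓞 L) L) (conjAdele (Fp L) L (IsCMField.complexConj L)) (conjAdele_conjAdele' L) y hy z t *
        ((jAdelic L 4).symm (UnitaryGroup.toAdelic (Fp L) L (IsCMField.complexConj L) (2 + 2) ((StdForm.antidiagonal (2 + 2)).over L) q))⁻¹)) := by
    rw [map_mul, map_mul, map_inv, MulEquiv.apply_symm_apply, map_mul, map_mul, map_inv]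
    simp only [MulEquiv.apply_symm_apply]
  rw [key]
  exact ⟨_, ⟨_, hqA, rfl⟩, rfl⟩

/-! ## §3 The identity-cell integrand is constant -/

/-- **THE IDENTITY-CELL INTEGRAND OF THE Q-CONSTANT TERM IS CONSTANT**: `f (Ψ(toAdelic q) · u · h) = f (Ψ(toAdelic q) · h)` for `q ∈ Q(L⁺)`, `u ∈ N_Q(𝔸)` and every
Siegel section `f` of `I(s, χ)` (★ F4-1 `apply_klingenUnipA_mul` after §2). [cite: Xiong2013, §4 Prop. 4.1] [cite: MoeglinWaldspurger1995, II.1.7] -/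
theorem apply_transport_klingen_mul_klingenUnipA {SA : GL (Fin (2 + 2)) (AdeleRing (𝓞 L) L)}
    {Ψ : (quasiSplit (Fp L) L (IsCMField.complexConj L) (2 + 2)).Adelic ≃ₜ* HA L e dV hdV dW hdW} {X Y : Matrix (Fin 2) (Fin 2) (Fp L)} {a : Fp L}
    (hΨ : ∀ g : (quasiSplit (Fp L) L (IsCMField.complexConj L) (2 + 2)).Adelic,
      (((Ψ g : HA L e dV hdV dW hdW) : GL (Fin (2 + 2)) (AdeleRing (𝓞 L) L)) : Matrix (Fin (2 + 2)) (Fin (2 + 2)) (AdeleRing (𝓞 L) L)) =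
        (SA : Matrix (Fin (2 + 2)) (Fin (2 + 2)) (AdeleRing (𝓞 L) L)) *
          ((adelicVal (Fp L) L (IsCMField.complexConj L) (2 + 2) _ g : GL (Fin (2 + 2)) (AdeleRing (𝓞 L) L)) :
            Matrix (Fin (2 + 2)) (Fin (2 + 2)) (AdeleRing (𝓞 L) L)) *
          ((SA⁻¹ : GL (Fin (2 + 2)) (AdeleRing (𝓞 L) L)) : Matrix (Fin (2 + 2)) (Fin (2 + 2)) (AdeleRing (𝓞 L) L)))
    (ha : a + a = 1)
    (hSA : Matrix.reindex (e₂ (n := 2)).symm (e₂ (n := 2)).symm (SA : Matrix (Fin (2 + 2)) (Fin (2 + 2)) (AdeleRing (𝓞 L) L)) =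
      Matrix.fromBlocks (1 : Matrix (Fin 2) (Fin 2) (AdeleRing (𝓞 L) L)) (X.map ((algebraMap L (AdeleRing (𝓞 L) L)).comp (algebraMap (Fp L) L))) 1
        (-(X.map ((algebraMap L (AdeleRing (𝓞 L) L)).comp (algebraMap (Fp L) L)))))
    (hSAi : Matrix.reindex (e₂ (n := 2)).symm (e₂ (n := 2)).symm ((SA⁻¹ : GL (Fin (2 + 2)) (AdeleRing (𝓞 L) L)) : Matrix (Fin (2 + 2)) (Fin (2 + 2)) (AdeleRing (𝓞 L) L)) =
      Matrix.fromBlocks ((a • (1 : Matrix (Fin 2) (Fin 2) (Fp L))).map ((algebraMap L (AdeleRing (𝓞 L) L)).comp (algebraMap (Fp L) L)))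
        ((a • (1 : Matrix (Fin 2) (Fin 2) (Fp L))).map ((algebraMap L (AdeleRing (𝓞 L) L)).comp (algebraMap (Fp L) L)))
        (Y.map ((algebraMap L (AdeleRing (𝓞 L) L)).comp (algebraMap (Fp L) L)))
        (-(Y.map ((algebraMap L (AdeleRing (𝓞 L) L)).comp (algebraMap (Fp L) L)))))
    (hΨP : ∀ b : (quasiSplit (Fp L) L (IsCMField.complexConj L) (2 + 2)).Adelic,
      ((adelicVal (Fp L) L (IsCMField.complexConj L) (2 + 2) _ b : GL (Fin (2 + 2)) (AdeleRing (𝓞 L) L)) :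
          Matrix (Fin (2 + 2)) (Fin (2 + 2)) (AdeleRing (𝓞 L) L)).BlockTriangular id →
        IsSiegelDelta L e dV hdV dW hdW (Ψ b))
    {χ : HeckeCharacter L} {s : ℂ} {f : HA L e dV hdV dW hdW → ℂ} (hf : IsSiegelDeltaSection L e dV hdV dW hdW χ s f)
    {q : unitaryGroupOfForm ((IsCMField.complexConj L : L ≃ₐ[Fp L] L) : L →+* L) ((StdForm.antidiagonal 4).over L)}
    (hq : q ∈ klingen L ((IsCMField.complexConj L : L ≃ₐ[Fp L] L) : L →+* L)) {u : HA L e dV hdV dW hdW} (hu : u ∈ klingenUnipA Ψ)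
    (h : HA L e dV hdV dW hdW) :
    f (Ψ (UnitaryGroup.toAdelic (Fp L) L (IsCMField.complexConj L) (2 + 2) ((StdForm.antidiagonal (2 + 2)).over L) q) * u * h) =
      f (Ψ (UnitaryGroup.toAdelic (Fp L) L (IsCMField.complexConj L) (2 + 2) ((StdForm.antidiagonal (2 + 2)).over L) q) * h) := by
  have hrew : Ψ (UnitaryGroup.toAdelic (Fp L) L (IsCMField.complexConj L) (2 + 2) ((StdForm.antidiagonal (2 + 2)).over L) q) * u * h =
      Ψ (UnitaryGroup.toAdelic (Fp L) L (IsCMField.complexConj L) (2 + 2) ((StdForm.antidiagonal (2 + 2)).over L) q) * u *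
          (Ψ (UnitaryGroup.toAdelic (Fp L) L (IsCMField.complexConj L) (2 + 2) ((StdForm.antidiagonal (2 + 2)).over L) q))⁻¹ *
        (Ψ (UnitaryGroup.toAdelic (Fp L) L (IsCMField.complexConj L) (2 + 2) ((StdForm.antidiagonal (2 + 2)).over L) q) * h) := by
    group
  rw [hrew]
  exact apply_klingenUnipA_mul hΨ ha hSA hSAi hΨP hf (conj_mem_klingenUnipA Ψ hq hu) _

end Summit.HodgeConjecture.HodgeConjecture.Cruxes.HLiu418.K2LiuKlingenCellOneConstant

end
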